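import Summits.ABC.StewartYu.PadicG3ParNE
import Summits.ABC.StewartYu.PadicG3ParVC
import HarnessLib

/-!
# The `𝔑`-threaded `p`-adic Gen-3 record `PadicG3ParN` — the extra-depth atom for the saturated pack

Support file (theorems only; no named facts). Cell `abc-stewartyu`, route `YuMatveevShapeRat`, crux `PadicCoreOddRat`
(stmt-ABC-20503, line `sat-odd`); seat p1 (record owner), for p2's pack twin (STATUS 18:15:58Z (Δ2)): the additive
`2(n+1)(ŜN − ŜG)` orders of the saturated schedule cost, in `T₀·HV` products, at most
**`2(n+1)(⌊log₂ N⌋ + 1)·(43/20)·HV ≤ Zp/2^12`** (`⌊log₂N⌋+1 ≤ N ≤ (2/log 2)ⁿΩ ≤ LgV/(24·21ⁿ)` by `C_b ≥ 64`,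
`HV ≤ G·XV/(64(n+1))`, `G·XV·LgV ≤ Zp`). (The `+6` form of the `AVN` atom asked there is already
`PadicG3ParN.AVpN_le`.)

## References
* [Nesterenko2003] Yu. V. Nesterenko, LNM 1819 (2003) — §3.4 (3.16), §4.2 (4.24).
-/

noncomputable section

open Finset Real

namespace Summit.ABC.StewartYu

namespace PadicG3ParN

open PadicG3Par (Cb cM cG Cb_pos sixtyfour_le_Cb)

variable {n : ℕ} (P : PadicG3ParN n)

/-- `N ≤ LgV/(24·21ⁿ)` under `gⁿ ≤ K` (`N ≤ (2/log 2)ⁿΩ`, `(2/log 2)·21 ≤ 63 ≤ C_b`, `24·C_bⁿ·Ω ≤ LgV`). [folklore] -/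
theorem N_le_LgV_div (hgK : P.g ^ n ≤ (P.K : ℝ)) : (P.N : ℝ) * (24 * 21 ^ n) ≤ P.LgV := by
  have h1 := P.hNΩ
  have h2 := P.core_Ω_le_LgV hgK
  have hl : Real.log 2 > 0.6931471803 := Real.log_two_gt_d9
  have h3 : (2 : ℝ) / Real.log 2 * 21 ≤ Cb := by
    have : (2 : ℝ) / Real.log 2 ≤ 3 := by rw [div_le_iff₀ (by linarith)]; linarith
    linarith [sixtyfour_le_Cb]
  have h0 : (0 : ℝ) ≤ 2 / Real.log 2 * 21 := by positivity
  have h4 : ((2 : ℝ) / Real.log 2) ^ n * 21 ^ n ≤ Cb ^ n := by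
    rw [← mul_pow]; exact pow_le_pow_left₀ h0 h3 n
  have hΩ := P.Ω_pos.le
  calc (P.N : ℝ) * (24 * 21 ^ n) ≤ (2 / Real.log 2) ^ n * P.Ω * (24 * 21 ^ n) :=
        mul_le_mul_of_nonneg_right h1 (by positivity)
    _ = 24 * (((2 : ℝ) / Real.log 2) ^ n * 21 ^ n) * P.Ω := by ring
    _ ≤ 24 * Cb ^ n * P.Ω := by nlinarith [mul_le_mul_of_nonneg_right h4 hΩ]
    _ ≤ P.LgV := h2

/-- **the extra-depth atom** `2(n+1)(⌊log₂N⌋ + 1)·(43/20)·HV ≤ Zp/2^12` under `gⁿ ≤ K`.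
[cite: Nesterenko2003, §4.2 (4.24); shape only] -/
theorem succ_logN_HV_le (hgK : P.g ^ n ≤ (P.K : ℝ)) :
    2 * ((n : ℝ) + 1) * ((Nat.log 2 P.N : ℝ) + 1) * ((43 / 20) * P.HV) ≤ P.Zp / 2 ^ 12 := by
  have hN : ((Nat.log 2 P.N : ℝ) + 1) ≤ P.N := by exact_mod_cast P.natlog_N_succ_le_N
  have hNL := P.N_le_LgV_div hgK
  have hH := P.HV_le
  have hG : 0 < P.G := lt_of_lt_of_le (by norm_num) P.eight_le_G
  have hX : (0 : ℝ) ≤ P.XV := Nat.cast_nonneg _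
  have hg := P.one_le_g
  have hL : (0 : ℝ) ≤ P.LgV := Nat.cast_nonneg _
  have hn : (0 : ℝ) < (n : ℝ) + 1 := by positivity
  -- `HV·(n+1) ≤ G·XV/64`
  have hH' : (P.HV : ℝ) * (64 * ((n : ℝ) + 1)) ≤ P.G * P.XV := by
    rw [le_div_iff₀ (by positivity)] at hH; linarith
  -- `21ⁿ ≥ 21`
  have h21 : (21 : ℝ) ≤ 21 ^ n := by
    calc (21 : ℝ) = 21 ^ 1 := (pow_one _).symm
      _ ≤ 21 ^ n := pow_le_pow_right₀ (by norm_num) (by have := P.hn; omega)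
  -- assemble: LHS ≤ 2(n+1)·N·(43/20)·HV ≤ (43/10)·N·(G XV/64) ≤ (43/640)·G·XV·LgV/(24·21ⁿ)
  have hZ : P.G * P.XV * P.LgV ≤ P.Zp := by
    unfold PadicG3Par.Zp
    have : P.XV * P.LgV ≤ P.g * P.XV * P.LgV := by nlinarith [mul_nonneg hX hL]
    nlinarith
  have hHV0 : (0 : ℝ) ≤ P.HV := Nat.cast_nonneg _
  have hN0 : (0 : ℝ) ≤ P.N := Nat.cast_nonneg _
  have s1 : 2 * ((n : ℝ) + 1) * ((Nat.log 2 P.N : ℝ) + 1) * ((43 / 20) * P.HV) ≤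
      (43 / 10) * P.N * (P.HV * ((n : ℝ) + 1)) := by nlinarith [mul_nonneg hHV0 hn.le]
  have s2 : (43 / 10 : ℝ) * P.N * (P.HV * ((n : ℝ) + 1)) ≤ (43 / 640) * P.N * (P.G * P.XV) := by
    nlinarith [mul_nonneg hN0 (mul_nonneg hG.le hX)]
  have s3 : (43 / 640 : ℝ) * P.N * (P.G * P.XV) * (24 * 21 ^ n) ≤ (43 / 640) * (P.G * P.XV) * P.LgV := by
    nlinarith [mul_nonneg hG.le hX]
  have h2112 : (2 : ℝ) ^ 12 * (43 / 640) ≤ 24 * 21 ^ n := by nlinarith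
  rw [le_div_iff₀ (by positivity)]
  have hGXL : 0 ≤ P.G * P.XV * P.LgV := by positivity
  nlinarith [mul_nonneg hGXL (show (0:ℝ) ≤ 21 ^ n by positivity)]

end PadicG3ParN

end Summit.ABC.StewartYu
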